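import Summits.AnomalousDissipation.AnomalousDissipation.Theorems.TwoAndHalfDTwohalfdThesisStubCoherenceOfEnergy
import Summits.AnomalousDissipation.AnomalousDissipation.Theorems.TwoAndHalfDTwohalfdThesisStubWeakDuhamel
import Summits.AnomalousDissipation.AnomalousDissipation.Theorems.TwoAndHalfDTwohalfdThesisStubFixedViscosityEnvelope
import Summits.AnomalousDissipation.AnomalousDissipation.Theorems.TwoAndHalfDTwohalfdThesisStubDuhamelVariance

/-!
# Tools for H1 `stub_gkFloorOfTail` — registered sub-stub `stub_gkFloorOfTailTools`

Tools file for the tool stub H1 of the line `Sketch` (duhamel-release) for the crux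
`Summit.AnomalousDissipation.AnomalousDissipation.Theses.TwoAndHalfD.TwohalfdThesis`
(stmt-AnomalousDissipation-0206), lead c3.  H1 (sequel file `…StubGKFloorOfTail.lean`) shows that the
Green–Kubo / no-echo clause of the kernel W (`stub_releasedMixingWitness`) is AUTOMATIC once the release
envelope's tail beyond the coherence time `τ_c = ‖h‖²/K` carries `≤ τ_c/4` (`K` a coherence rate,
`⟪h, φ s (t)⟫ ≥ ‖h‖² - K(t-s)`, e.g. the landed coherence gate p97305).  THIS FILE proves the tools:

* `exists_continuousOn_releasePairing` — the datum correlation `s ↦ ⟪h, φ s (t)⟫` of classical releases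
  is continuous in the release time on `[0, t]` (forward–backward duality with the reversed solution from
  `h`, exactly as in the landed weak Duhamel identity p87403);
* `abs_releasePairing_le`, `…_of_envelope`, `…_exp` — Cauchy–Schwarz bounds on the correlation from the
  `L²` contraction, the envelope, and the fixed-diffusivity decay of zero-mean releases (p98636);
* `le_liminf_timeMean_of_eventually_le` — Cesàro bookkeeping (liminf form);
* `gk_integral_lower_bound` — for `t ≥ s₀ + τ_c`: `‖h‖²τ_c/4 - s₀‖h‖²√(e^{-8π²κ(t-s₀)}) ≤ ∫₀ᵗ ⟪h, φ s (t)⟫ ds`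
  (split `[0,t]` at `s₀` and `t - τ_c`: fixed-diffusivity decay / envelope tail / coherence);
bundled as the registered sub-stub `stub_gkFloorOfTailTools` (their conjunction, verbatim).
Supports stmt-AnomalousDissipation-0206. [folklore: Taylor 1921 / Green–Kubo representation of the eddy
flux; DEIJ 2022, §1 (1.1)–(1.3); Evans 2010, §7.1.1 (adjoint problem)]
-/

noncomputable section

-- the summit path `AnomalousDissipation/AnomalousDissipation` duplicates a namespace component
set_option linter.dupNamespace false

namespace Summit.AnomalousDissipation.AnomalousDissipation.Theorems.TwohalfdThesis

open MeasureTheory Set Filter Topology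
open scoped ENNReal NNReal InnerProductSpace
open Literature.Analysis.FunctionSpaces Literature.Analysis.FluidPDE

variable {d : Type*} [Fintype d] [DecidableEq d]

/-! ## Continuity of the datum correlation in the release time (duality) -/

/-- **The datum correlation is continuous in the release time.** For `κ > 0`, `t > 0`, smooth `h` and
classical unforced releases `φ s` of `h` at every `s ≥ 0` over one drift, there is a continuous `D` on
`[0, t]` with `∫ h φ s (t) = D s` (`s ∈ [0, t]`): `D s = ∫ h χ̃(t-s)` with `χ̃` the reversed solution from
`h` on `[0, t]` (`Torus.exists_isClassicalScalarTransportForcedOn`, `integral_mul_eq_of_reverse_shifted`).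
[folklore] -/
theorem exists_continuousOn_releasePairing {κ t : ℝ}
    {u : ℝ → UnitAddTorus d → EuclideanSpace ℝ d} {h : UnitAddTorus d → ℝ}
    {φ : ℝ → ℝ → UnitAddTorus d → ℝ} (hκ : 0 < κ) (ht : 0 < t) (hh : Torus.IsSmooth h)
    (hφ : ∀ s, 0 ≤ s → Torus.IsClassicalScalarTransportOn (Ici s) κ u (φ s) ∧ φ s s = h) :
    ∃ D : ℝ → ℝ, ContinuousOn D (Icc 0 t) ∧ ∀ s ∈ Icc 0 t, ∫ x, h x * φ s t x = D s := by
  have hu : Torus.IsSmoothSpaceTimeOn (Icc 0 t) u :=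
    (hφ 0 le_rfl).1.smooth_velocity.mono Icc_subset_Ici_self
  have hdiv : ∀ σ ∈ Icc 0 t, Torus.IsDivFree (u σ) := fun σ hσ =>
    (hφ 0 le_rfl).1.divFree σ (Icc_subset_Ici_self hσ)
  have h0 : Torus.IsSmoothSpaceTimeOn (Icc 0 t) (fun (_ : ℝ) (_ : UnitAddTorus d) => (0 : ℝ)) :=
    Torus.isSmoothSpaceTimeOn_const (Torus.isSmooth_const _) _
  obtain ⟨χt, hχt', hχt0⟩ := Torus.exists_isClassicalScalarTransportForcedOn hκ ht
    (Torus.isSmoothSpaceTimeOn_reverse_neg hu) (Torus.isDivFree_reverse hdiv) h0 hh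
  have hχt : Torus.IsClassicalScalarTransportOn (Icc 0 t) κ (fun σ x => -u (t - σ) x) χt :=
    isClassicalScalarTransportOn_of_forced_zero hχt'
  have hχrs : Torus.IsSmoothSpaceTimeOn (Icc 0 t) (fun σ x => χt (t - σ) x) :=
    Torus.IsSmoothSpaceTimeOn.reverse hχt.smooth_scalar
  refine ⟨fun s => ∫ x, h x * χt (t - s) x, ?_, ?_⟩
  · exact ((Torus.isSmoothSpaceTimeOn_const hh _).mul hχrs).continuousOn_integral (convex_Icc 0 t)
  · intro s hs
    rcases eq_or_lt_of_le hs.2 with hst | hst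
    · simp only [hst, sub_self, hχt0, (hφ t ht.le).2]
    · have hφs : Torus.IsClassicalScalarTransportOn (Icc s t) κ u (φ s) :=
        ((hφ s hs.1).1).restrict_Icc hst Icc_subset_Ici_self
      have hχs : Torus.IsClassicalScalarTransportOn (Icc 0 (t - s)) κ
          (fun σ x => -u (t - σ) x) χt :=
        hχt.restrict_Icc (sub_pos.2 hst) (Icc_subset_Icc le_rfl (sub_le_self t hs.1))
      have e := integral_mul_eq_of_reverse_shifted hst hφs hχs
      rw [hχt0, (hφ s hs.1).2] at e
      show ∫ x, h x * φ s t x = ∫ x, h x * χt (t - s) x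
      rw [← e]
      exact integral_congr_ae (Eventually.of_forall fun x => mul_comm _ _)

/-! ## Pointwise bounds on the datum correlation -/

omit [DecidableEq d] in
/-- `√N · √(a N) = √a · N` for `N ≥ 0`. [folklore] -/
theorem sqrt_mul_sqrt_mul_eq {a N : ℝ} (hN : 0 ≤ N) :
    Real.sqrt N * Real.sqrt (a * N) = Real.sqrt a * N := by
  rw [Real.sqrt_mul' a hN, mul_comm (Real.sqrt N), mul_assoc, Real.mul_self_sqrt hN]

/-- **`L²` contraction bound.** For a classical unforced release `φ` of the smooth `h` at time `s`
(`κ ≥ 0`) and `t ≥ s`: `|∫ h φ(t)| ≤ ‖h‖²_{L²}` (Cauchy–Schwarz and `‖φ(t)‖ ≤ ‖φ(s)‖ = ‖h‖`).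
[folklore] -/
theorem abs_releasePairing_le {κ s t : ℝ} {u : ℝ → UnitAddTorus d → EuclideanSpace ℝ d}
    {h : UnitAddTorus d → ℝ} {φ : ℝ → UnitAddTorus d → ℝ} (hκ : 0 ≤ κ) (hh : Torus.IsSmooth h)
    (hsol : Torus.IsClassicalScalarTransportOn (Ici s) κ u φ) (hφs : φ s = h) (hst : s ≤ t) :
    |∫ x, h x * φ t x| ≤ Torus.scalarL2Sq h := by
  have hN : 0 ≤ Torus.scalarL2Sq h := Torus.scalarL2Sq_nonneg h
  have hφt : Torus.IsSmooth (φ t) := hsol.smooth_scalar.isSmooth_slice (show t ∈ Ici s from hst)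
  have hcs := abs_integral_mul_le (hh.memLp 2) (hφt.memLp 2)
  have hanti : Torus.scalarL2Sq (φ t) ≤ Torus.scalarL2Sq (φ s) :=
    hsol.antitoneOn_scalarL2Sq hκ Icc_subset_Ici_self (left_mem_Icc.2 hst) (right_mem_Icc.2 hst) hst
  rw [hφs] at hanti
  calc |∫ x, h x * φ t x| ≤ Real.sqrt (Torus.scalarL2Sq h) * Real.sqrt (Torus.scalarL2Sq (φ t)) := hcs
    _ ≤ Real.sqrt (Torus.scalarL2Sq h) * Real.sqrt (Torus.scalarL2Sq h) :=
        mul_le_mul_of_nonneg_left (Real.sqrt_le_sqrt hanti) (Real.sqrt_nonneg _)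
    _ = Torus.scalarL2Sq h := Real.mul_self_sqrt hN

omit [DecidableEq d] in
/-- **Envelope bound.** `‖φ(t)‖² ≤ Λ²‖h‖²`, `Λ ≥ 0` ⟹ `|∫ h φ(t)| ≤ Λ‖h‖²` (Cauchy–Schwarz). [folklore] -/
theorem abs_releasePairing_le_of_envelope {Λ : ℝ} {h φt : UnitAddTorus d → ℝ}
    (hh : Torus.IsSmooth h) (hφt : Torus.IsSmooth φt) (hΛ : 0 ≤ Λ)
    (henv : Torus.scalarL2Sq φt ≤ Λ ^ 2 * Torus.scalarL2Sq h) :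
    |∫ x, h x * φt x| ≤ Λ * Torus.scalarL2Sq h := by
  have hN : 0 ≤ Torus.scalarL2Sq h := Torus.scalarL2Sq_nonneg h
  have hcs := abs_integral_mul_le (hh.memLp 2) (hφt.memLp 2)
  calc |∫ x, h x * φt x| ≤ Real.sqrt (Torus.scalarL2Sq h) * Real.sqrt (Torus.scalarL2Sq φt) := hcs
    _ ≤ Real.sqrt (Torus.scalarL2Sq h) * Real.sqrt (Λ ^ 2 * Torus.scalarL2Sq h) :=
        mul_le_mul_of_nonneg_left (Real.sqrt_le_sqrt henv) (Real.sqrt_nonneg _)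
    _ = Real.sqrt (Λ ^ 2) * Torus.scalarL2Sq h := sqrt_mul_sqrt_mul_eq hN
    _ = Λ * Torus.scalarL2Sq h := by rw [Real.sqrt_sq hΛ]

/-- **Early releases decay at fixed diffusivity.** For `κ > 0`, a smooth ZERO-MEAN `h`, a classical
unforced release `φ` of `h` at time `s` and `s ≤ s₀ ≤ t`:
`|∫ h φ(t)| ≤ √(e^{-8π²κ(t-s₀)}) ‖h‖²_{L²}` (the fixed-diffusivity envelope
`stub_fixedViscosityEnvelope` and Cauchy–Schwarz; monotonicity in the release time). [folklore] -/
theorem abs_releasePairing_le_exp {κ s s₀ t : ℝ}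
    {u : ℝ → UnitAddTorus (Fin 2) → EuclideanSpace ℝ (Fin 2)}
    {h : UnitAddTorus (Fin 2) → ℝ} {φ : ℝ → UnitAddTorus (Fin 2) → ℝ} (hκ : 0 < κ)
    (hh : Torus.IsSmooth h) (hhz : Torus.HasZeroMean h)
    (hsol : Torus.IsClassicalScalarTransportOn (Ici s) κ u φ) (hφs : φ s = h) (hss₀ : s ≤ s₀)
    (hs₀t : s₀ ≤ t) :
    |∫ x, h x * φ t x| ≤
      Real.sqrt (Real.exp (-(8 * Real.pi ^ 2 * κ) * (t - s₀))) * Torus.scalarL2Sq h := by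
  have hN : 0 ≤ Torus.scalarL2Sq h := Torus.scalarL2Sq_nonneg h
  have hst : s ≤ t := hss₀.trans hs₀t
  have hφt : Torus.IsSmooth (φ t) := hsol.smooth_scalar.isSmooth_slice (show t ∈ Ici s from hst)
  have h1 := stub_fixedViscosityEnvelope κ s u h φ hκ hh hhz hsol hφs t hst
  have h2 : Real.exp (-(8 * Real.pi ^ 2 * κ) * (t - s)) ≤
      Real.exp (-(8 * Real.pi ^ 2 * κ) * (t - s₀)) := by
    refine Real.exp_le_exp.2 ?_
    have hc : 0 ≤ 8 * Real.pi ^ 2 * κ := by positivity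
    nlinarith
  have h3 : Torus.scalarL2Sq (φ t) ≤
      Real.exp (-(8 * Real.pi ^ 2 * κ) * (t - s₀)) * Torus.scalarL2Sq h :=
    h1.trans (mul_le_mul_of_nonneg_right h2 hN)
  have hcs := abs_integral_mul_le (hh.memLp 2) (hφt.memLp 2)
  calc |∫ x, h x * φ t x| ≤ Real.sqrt (Torus.scalarL2Sq h) * Real.sqrt (Torus.scalarL2Sq (φ t)) := hcs
    _ ≤ Real.sqrt (Torus.scalarL2Sq h) *
          Real.sqrt (Real.exp (-(8 * Real.pi ^ 2 * κ) * (t - s₀)) * Torus.scalarL2Sq h) :=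
        mul_le_mul_of_nonneg_left (Real.sqrt_le_sqrt h3) (Real.sqrt_nonneg _)
    _ = Real.sqrt (Real.exp (-(8 * Real.pi ^ 2 * κ) * (t - s₀))) * Torus.scalarL2Sq h :=
        sqrt_mul_sqrt_mul_eq hN

/-! ## Real-variable bookkeeping -/

omit [DecidableEq d] in
/-- `∫_{t-τ}^{t} (N - K (t - s)) ds = N τ - K τ² / 2` (substitute the age `t - s`). [folklore] -/
theorem integral_coherence_line (N K t τ : ℝ) :
    ∫ s in (t - τ)..t, (N - K * (t - s)) = N * τ - K * τ ^ 2 / 2 := by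
  have h := intervalIntegral.integral_comp_sub_left (fun σ => N - K * σ) t (a := t - τ) (b := t)
  simp only [sub_sub_cancel, sub_self] at h
  have hderiv : ∀ x ∈ uIcc 0 τ, HasDerivAt (fun x => N * x - K * x ^ 2 / 2) (N - K * x) x := by
    intro x _
    have h1 : HasDerivAt (fun x => N * x) N x := by simpa using (hasDerivAt_id x).const_mul N
    have h3 := ((hasDerivAt_pow 2 x).const_mul K).div_const 2
    exact h1.sub (h3.congr_deriv (by push_cast; ring))
  rw [h, intervalIntegral.integral_eq_sub_of_hasDerivAt hderiv
    ((continuous_const.sub (continuous_const.mul continuous_id)).intervalIntegrable 0 τ)]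
  ring

/-- **Cesàro bookkeeping (liminf form).** If `P` is interval integrable on every `[0, T]`,
`|P t| ≤ B₀` for `t > 0`, and for every `δ > 0` eventually `a - δ ≤ P t`, then
`a ≤ liminf_T T⁻¹∫₀ᵀ P` (the means are eventually `≥ a - 2δ` and bounded above by `B₀`, which makes
the `liminf` honest). [folklore] -/
theorem le_liminf_timeMean_of_eventually_le {P : ℝ → ℝ} {a B₀ : ℝ}
    (hint : ∀ T, 0 ≤ T → IntervalIntegrable P volume 0 T) (hB : ∀ t, 0 < t → |P t| ≤ B₀)
    (hev : ∀ δ, 0 < δ → ∃ T₁, 0 ≤ T₁ ∧ ∀ t, T₁ ≤ t → a - δ ≤ P t) :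
    a ≤ liminf (timeMean P) atTop := by
  have hB0 : 0 ≤ B₀ := (abs_nonneg _).trans (hB 1 one_pos)
  -- the means are bounded above by `B₀`
  have hup : ∀ T, 0 < T → timeMean P T ≤ B₀ := by
    intro T hT
    have h1 : ‖∫ t in (0 : ℝ)..T, P t‖ ≤ B₀ * |T - 0| :=
      intervalIntegral.norm_integral_le_of_norm_le_const fun t ht => by
        rw [uIoc_of_le hT.le] at ht
        rw [Real.norm_eq_abs]
        exact hB t ht.1
    rw [sub_zero, abs_of_pos hT, Real.norm_eq_abs] at h1
    have h2 : ∫ t in (0 : ℝ)..T, P t ≤ B₀ * T := (le_abs_self _).trans h1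
    rw [timeMean]
    calc T⁻¹ * ∫ t in (0 : ℝ)..T, P t ≤ T⁻¹ * (B₀ * T) :=
          mul_le_mul_of_nonneg_left h2 (inv_nonneg.2 hT.le)
      _ = B₀ := by field_simp
  have hcob : IsCoboundedUnder (· ≥ ·) atTop (timeMean P) :=
    IsBoundedUnder.isCoboundedUnder_ge ⟨B₀, eventually_atTop.2 ⟨1, fun T hT => hup T (by linarith)⟩⟩
  refine le_of_forall_sub_le fun ε hε => ?_
  obtain ⟨T₁, hT₁0, hT₁⟩ := hev (ε / 2) (half_pos hε)
  -- for `T ≥ T₂` the mean is `≥ a - ε`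
  set c : ℝ := B₀ * T₁ + T₁ * |a - ε / 2| with hc
  have hc0 : 0 ≤ c := by positivity
  refine le_liminf_of_le hcob (eventually_atTop.2 ⟨max (T₁ + 1) (2 * c / ε + 1), fun T hT => ?_⟩)
  have hTT₁ : T₁ + 1 ≤ T := (le_max_left _ _).trans hT
  have hTc : 2 * c / ε + 1 ≤ T := (le_max_right _ _).trans hT
  have hT0 : 0 < T := by linarith
  have hT₁T : T₁ ≤ T := by linarith
  -- split `[0, T]` at `T₁`
  have i1 : IntervalIntegrable P volume 0 T₁ := hint T₁ hT₁0
  have i2 : IntervalIntegrable P volume T₁ T := (hint T hT0.le).mono_set (by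
    rw [uIcc_of_le hT₁T, uIcc_of_le hT0.le]; exact Icc_subset_Icc hT₁0 le_rfl)
  have hI1 : -(B₀ * T₁) ≤ ∫ t in (0 : ℝ)..T₁, P t := by
    have h1 : ‖∫ t in (0 : ℝ)..T₁, P t‖ ≤ B₀ * |T₁ - 0| :=
      intervalIntegral.norm_integral_le_of_norm_le_const fun t ht => by
        rw [uIoc_of_le hT₁0] at ht
        rw [Real.norm_eq_abs]
        exact hB t ht.1
    rw [sub_zero, abs_of_nonneg hT₁0, Real.norm_eq_abs] at h1
    exact (abs_le.1 h1).1
  have hI2 : (a - ε / 2) * (T - T₁) ≤ ∫ t in T₁..T, P t := by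
    have h1 : ∫ t in T₁..T, (a - ε / 2) ≤ ∫ t in T₁..T, P t :=
      intervalIntegral.integral_mono_on hT₁T intervalIntegrable_const i2
        fun t ht => hT₁ t ht.1
    rwa [intervalIntegral.integral_const, smul_eq_mul, mul_comm] at h1
  have hsum : ∫ t in (0 : ℝ)..T, P t = (∫ t in (0 : ℝ)..T₁, P t) + ∫ t in T₁..T, P t :=
    (intervalIntegral.integral_add_adjacent_intervals i1 i2).symm
  -- the mean
  have hlow : (a - ε / 2) * T - c ≤ ∫ t in (0 : ℝ)..T, P t := by
    rw [hsum]
    have h3 : (a - ε / 2) * T₁ ≤ T₁ * |a - ε / 2| := by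
      rw [mul_comm]; exact mul_le_mul_of_nonneg_left (le_abs_self _) hT₁0
    have hid : (a - ε / 2) * T - c =
        (a - ε / 2) * (T - T₁) + ((a - ε / 2) * T₁ - T₁ * |a - ε / 2|) - B₀ * T₁ := by
      rw [hc]; ring
    rw [hid]
    linarith
  rw [timeMean]
  have hkey : a - ε ≤ T⁻¹ * ((a - ε / 2) * T - c) := by
    have h7 : T⁻¹ * ((a - ε / 2) * T - c) = (a - ε / 2) - c / T := by
      field_simp
    rw [h7]
    have h5 : 2 * c / ε ≤ T := by linarith
    have h6 : 2 * c ≤ T * ε := by rwa [div_le_iff₀ hε] at h5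
    have h4 : c / T ≤ ε / 2 := by
      rw [div_le_iff₀ hT0]
      linarith
    linarith
  exact hkey.trans (mul_le_mul_of_nonneg_left hlow (inv_nonneg.2 hT0.le))

/-! ## The lower bound on the Duhamel integral at a late time -/

/-- **Lower bound on the Green–Kubo integral at one late time.** Under the hypotheses of
`gkFloor_of_coherence_of_envelopeTail` (coherence rate `K > 0`, envelope after `s₀` with tail
`∫_{[τ_c,∞)} Λ ≤ τ_c/4`, `τ_c = N/K`, `N = ‖h‖²`), for every `t ≥ s₀ + τ_c`:
`N τ_c / 4 - s₀ N √(e^{-8π²κ(t-s₀)}) ≤ ∫₀ᵗ ⟪h, φ s (t)⟫ ds` (split `[0,t]` at `s₀` and `t - τ_c`;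
early releases by the fixed-diffusivity decay, middle ages by the envelope tail, young ages by
coherence, `∫_{t-τ_c}^t (N - K(t-s)) ds = N τ_c/2`). [folklore] -/
theorem gk_integral_lower_bound {κ K s₀ t : ℝ}
    {u : ℝ → UnitAddTorus (Fin 2) → EuclideanSpace ℝ (Fin 2)} {h : UnitAddTorus (Fin 2) → ℝ}
    {φ : ℝ → ℝ → UnitAddTorus (Fin 2) → ℝ} {Λ : ℝ → ℝ}
    (hκ : 0 < κ) (hh : Torus.IsSmooth h) (hhz : Torus.HasZeroMean h) (hK : 0 < K)
    (hφ : ∀ s, 0 ≤ s → Torus.IsClassicalScalarTransportOn (Ici s) κ u (φ s) ∧ φ s s = h)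
    (hcoh : ∀ s t, 0 ≤ s → s ≤ t → Torus.scalarL2Sq h - K * (t - s) ≤ ∫ x, h x * φ s t x)
    (hs₀ : 0 ≤ s₀) (hΛ : ∀ τ, 0 ≤ Λ τ) (hΛi : IntegrableOn Λ (Ici 0))
    (henv : ∀ s t, s₀ ≤ s → s ≤ t → Torus.scalarL2Sq (φ s t) ≤ Λ (t - s) ^ 2 * Torus.scalarL2Sq h)
    (htail : ∫ τ in Ici (Torus.scalarL2Sq h / K), Λ τ ≤ Torus.scalarL2Sq h / K / 4)
    (ht : s₀ + Torus.scalarL2Sq h / K ≤ t) :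
    Torus.scalarL2Sq h * (Torus.scalarL2Sq h / K) / 4 -
        s₀ * Torus.scalarL2Sq h * Real.sqrt (Real.exp (-(8 * Real.pi ^ 2 * κ) * (t - s₀))) ≤
      ∫ s in (0 : ℝ)..t, ∫ x, h x * φ s t x := by
  set N : ℝ := Torus.scalarL2Sq h with hN_def
  set τc : ℝ := N / K with hτc_def
  have hN : 0 ≤ N := Torus.scalarL2Sq_nonneg h
  have hτc : 0 ≤ τc := div_nonneg hN hK.le
  have hKτ : K * τc = N := by rw [hτc_def]; field_simp
  have ht0 : 0 ≤ t := hs₀.trans ((le_add_of_nonneg_right hτc).trans ht)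
  have hs₀m : s₀ ≤ t - τc := by linarith
  have hmt : t - τc ≤ t := by linarith
  set r : ℝ := Real.sqrt (Real.exp (-(8 * Real.pi ^ 2 * κ) * (t - s₀))) with hr_def
  have hr : 0 ≤ r := Real.sqrt_nonneg _
  -- the correlation as a function of the release time, continuous on `[0, t]` when `t > 0`
  rcases eq_or_lt_of_le ht0 with ht0' | htpos
  · -- `t = 0`: then `s₀ = τc = 0` and `N = 0`, so the left-hand side is `≤ 0 = ∫₀⁰`
    have hτ0 : τc = 0 := by linarith
    have hN0 : N = 0 := by rw [← hKτ, hτ0, mul_zero]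
    rw [← ht0', intervalIntegral.integral_same]
    simp [hN0]
  obtain ⟨D, hDc, hD⟩ := exists_continuousOn_releasePairing hκ htpos hh hφ
  have hcongr : ∫ s in (0 : ℝ)..t, ∫ x, h x * φ s t x = ∫ s in (0 : ℝ)..t, D s :=
    intervalIntegral.integral_congr fun s hs => hD s (by rwa [uIcc_of_le ht0] at hs)
  rw [hcongr]
  have hDi : ∀ a b, 0 ≤ a → a ≤ b → b ≤ t → IntervalIntegrable D volume a b := fun a b ha hab hb =>
    (hDc.mono (by rw [uIcc_of_le hab]; exact Icc_subset_Icc ha hb)).intervalIntegrable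
  -- pointwise bounds on `D`
  have hD1 : ∀ s, 0 ≤ s → s ≤ s₀ → |D s| ≤ r * N := by
    intro s hs hss₀
    rw [← hD s ⟨hs, hss₀.trans (hs₀m.trans hmt)⟩]
    exact abs_releasePairing_le_exp hκ hh hhz (hφ s hs).1 (hφ s hs).2 hss₀ (hs₀m.trans hmt)
  have hD2 : ∀ s, s₀ ≤ s → s ≤ t → |D s| ≤ Λ (t - s) * N := by
    intro s hs hst
    have hs0 : 0 ≤ s := hs₀.trans hs
    rw [← hD s ⟨hs0, hst⟩]
    exact abs_releasePairing_le_of_envelope hh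
      ((hφ s hs0).1.smooth_scalar.isSmooth_slice (show t ∈ Ici s from hst)) (hΛ _)
      (henv s t hs hst)
  have hD3 : ∀ s, t - τc ≤ s → s ≤ t → N - K * (t - s) ≤ D s := by
    intro s hs hst
    have hs0 : 0 ≤ s := (hs₀.trans hs₀m).trans hs
    rw [← hD s ⟨hs0, hst⟩]
    exact hcoh s t hs0 hst
  -- (1) early releases
  have hI1 : -(s₀ * N * r) ≤ ∫ s in (0 : ℝ)..s₀, D s := by
    have h1 : ‖∫ s in (0 : ℝ)..s₀, D s‖ ≤ r * N * |s₀ - 0| :=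
      intervalIntegral.norm_integral_le_of_norm_le_const fun s hs => by
        rw [uIoc_of_le hs₀] at hs
        rw [Real.norm_eq_abs]
        exact hD1 s hs.1.le hs.2
    rw [sub_zero, abs_of_nonneg hs₀, Real.norm_eq_abs] at h1
    have := (abs_le.1 h1).1
    linarith
  -- (2) middle ages
  have hI2 : -(N * (τc / 4)) ≤ ∫ s in s₀..(t - τc), D s := by
    have hint : IntervalIntegrable (fun s => Λ (t - s) * N) volume s₀ (t - τc) :=
      (intervalIntegrable_comp_sub_left_of_integrableOn hΛi (hs₀m.trans hmt)).mul_const N |>.mono_set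
        (by rw [uIcc_of_le hs₀m, uIcc_of_le (hs₀m.trans hmt)]; exact Icc_subset_Icc le_rfl hmt)
    have h1 : ‖∫ s in s₀..(t - τc), D s‖ ≤ ∫ s in s₀..(t - τc), Λ (t - s) * N :=
      intervalIntegral.norm_integral_le_of_norm_le hs₀m (ae_of_all _ fun s hs => by
        rw [Real.norm_eq_abs]
        exact hD2 s hs.1.le (hs.2.trans hmt)) hint
    have h2 : ∫ s in s₀..(t - τc), Λ (t - s) * N ≤ N * (τc / 4) := by
      rw [intervalIntegral.integral_mul_const, mul_comm _ N, intervalIntegral.integral_comp_sub_left Λ t,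
        sub_sub_cancel]
      refine mul_le_mul_of_nonneg_left ?_ hN
      rw [intervalIntegral.integral_of_le (by linarith : τc ≤ t - s₀)]
      refine le_trans (setIntegral_mono_set (hΛi.mono_set (Ici_subset_Ici.2 hτc))
        (ae_of_all _ fun τ => hΛ τ) (ae_of_all _ fun τ hτ => (le_of_lt hτ.1 : τ ∈ Ici τc))) ?_
      simpa [hτc_def, hN_def] using htail
    rw [Real.norm_eq_abs] at h1
    have := (abs_le.1 (h1.trans h2)).1
    linarith
  -- (3) young ages
  have hI3 : N * τc / 2 ≤ ∫ s in (t - τc)..t, D s := by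
    have h1 : ∫ s in (t - τc)..t, (N - K * (t - s)) ≤ ∫ s in (t - τc)..t, D s :=
      intervalIntegral.integral_mono_on hmt
        ((continuousOn_const.sub (continuousOn_const.mul
          (continuousOn_const.sub continuousOn_id))).intervalIntegrable_of_Icc hmt)
        (hDi _ _ (hs₀.trans hs₀m) hmt le_rfl) fun s hs => hD3 s hs.1 hs.2
    rw [integral_coherence_line] at h1
    have h2 : N * τc - K * τc ^ 2 / 2 = N * τc / 2 := by
      rw [sq, ← mul_assoc, hKτ]; ring
    linarith
  -- sum up
  have hsplit : ∫ s in (0 : ℝ)..t, D s =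
      (∫ s in (0 : ℝ)..s₀, D s) + ((∫ s in s₀..(t - τc), D s) + ∫ s in (t - τc)..t, D s) := by
    rw [intervalIntegral.integral_add_adjacent_intervals (hDi _ _ hs₀ hs₀m hmt)
        (hDi _ _ (hs₀.trans hs₀m) hmt le_rfl),
      intervalIntegral.integral_add_adjacent_intervals (hDi _ _ le_rfl hs₀ (hs₀m.trans hmt))
        (hDi _ _ hs₀ (hs₀m.trans hmt) le_rfl)]
  rw [hsplit]
  have : N * (N / K) / 4 = N * τc / 2 - N * (τc / 4) := by rw [hτc_def]; ring
  linarith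

/-! ## The registered tools sub-stub -/

/-- **H1-tools `stub_gkFloorOfTailTools` (line `Sketch` = duhamel-release, crux `TwoAndHalfD.TwohalfdThesis`;
registered signature = the conjunction of this file's three tools):** (i) continuity of the datum
correlation `s ↦ ⟪h, φ s (t)⟫` in the release time (duality); (ii) Cesàro bookkeeping: an eventually
`≥ a - δ` (every `δ > 0`), bounded, locally integrable signal has `liminf` of running means `≥ a`;
(iii) the one-time lower bound `N τ_c/4 - s₀ N √(e^{-8π²κ(t-s₀)}) ≤ ∫₀ᵗ ⟪h, φ s (t)⟫ ds` for
`t ≥ s₀ + τ_c` under coherence rate `K`, envelope after `s₀` and tail `∫_{[τ_c,∞)} Λ ≤ τ_c/4`.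
[folklore] -/
theorem stub_gkFloorOfTailTools :
    (∀ (κ t : ℝ) (u : ℝ → (UnitAddTorus (Fin 2)) → (EuclideanSpace ℝ (Fin 2))) (h : (UnitAddTorus (Fin 2)) → ℝ)
        (φ : ℝ → ℝ → (UnitAddTorus (Fin 2)) → ℝ),
        0 < κ → 0 < t → Torus.IsSmooth h →
        (∀ s, 0 ≤ s → Torus.IsClassicalScalarTransportOn (Ici s) κ u (φ s) ∧ φ s s = h) →
        ∃ D : ℝ → ℝ, ContinuousOn D (Icc 0 t) ∧ ∀ s ∈ Icc 0 t, ∫ x, h x * φ s t x = D s) ∧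
    (∀ (P : ℝ → ℝ) (a B₀ : ℝ),
        (∀ T, 0 ≤ T → IntervalIntegrable P volume 0 T) → (∀ t, 0 < t → |P t| ≤ B₀) →
        (∀ δ, 0 < δ → ∃ T₁, 0 ≤ T₁ ∧ ∀ t, T₁ ≤ t → a - δ ≤ P t) →
        a ≤ liminf (timeMean P) atTop) ∧
    (∀ (κ K s₀ t : ℝ) (u : ℝ → (UnitAddTorus (Fin 2)) → (EuclideanSpace ℝ (Fin 2))) (h : (UnitAddTorus (Fin 2)) → ℝ)
        (φ : ℝ → ℝ → (UnitAddTorus (Fin 2)) → ℝ) (Λ : ℝ → ℝ),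
        0 < κ → Torus.IsSmooth h → Torus.HasZeroMean h → 0 < K →
        (∀ s, 0 ≤ s → Torus.IsClassicalScalarTransportOn (Ici s) κ u (φ s) ∧ φ s s = h) →
        (∀ s r, 0 ≤ s → s ≤ r → Torus.scalarL2Sq h - K * (r - s) ≤ ∫ x, h x * φ s r x) →
        0 ≤ s₀ → (∀ τ, 0 ≤ Λ τ) → IntegrableOn Λ (Ici 0) →
        (∀ s r, s₀ ≤ s → s ≤ r → Torus.scalarL2Sq (φ s r) ≤ Λ (r - s) ^ 2 * Torus.scalarL2Sq h) →
        (∫ τ in Ici (Torus.scalarL2Sq h / K), Λ τ) ≤ Torus.scalarL2Sq h / K / 4 →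
        s₀ + Torus.scalarL2Sq h / K ≤ t →
        Torus.scalarL2Sq h * (Torus.scalarL2Sq h / K) / 4 -
            s₀ * Torus.scalarL2Sq h * Real.sqrt (Real.exp (-(8 * Real.pi ^ 2 * κ) * (t - s₀))) ≤
          ∫ s in (0 : ℝ)..t, ∫ x, h x * φ s t x) :=
  ⟨fun _ _ _ _ _ hκ ht hh hφ => exists_continuousOn_releasePairing hκ ht hh hφ,
    fun _ _ _ hint hB hev => le_liminf_timeMean_of_eventually_le hint hB hev,
    fun _ _ _ _ _ _ _ _ hκ hh hhz hK hφ hcoh hs₀ hΛ hΛi henv htail ht =>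
      gk_integral_lower_bound hκ hh hhz hK hφ hcoh hs₀ hΛ hΛi henv htail ht⟩

end Summit.AnomalousDissipation.AnomalousDissipation.Theorems.TwohalfdThesis

end
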